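import Mathlib
import HarnessLib
import Summits.HodgeConjecture.HodgeConjecture.Theses.PadicSemiregularLift
import Literature.AlgebraicGeometry.Resolution.MarkedIdealsLemmas
import Literature.AlgebraicGeometry.Deformation.SquareZeroExtensionObstruction

/-!
# drefute evidence (refuter-drefute-stmt-HodgeConjecture-13815-0): PROOFS of the tower stubs G1, G2
# of line `sigma-ob-kzero-additivity` (crux `PadicPridhamSemiregularity`, stmt-HodgeConjecture-13815)

Candidate proofs (positive lemmas are NOT landed by the refuter, D-0016; attached as item evidence for
the line lead prover-line-stmt-HodgeConjecture-13815-0 to land, e.g. under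
`Theorems/PadicPridhamSemiregularity/…` with `--supports stmt-HodgeConjecture-13815`):

* `stub_specialFibreToThickening_closedImmersion_proof` — stub **G2** VERBATIM: `X_k ⟶ X_{n+1}` is a
  closed immersion (any `W(k)`-scheme, any ring `k` of characteristic `p`): `MorphismProperty.pullbackMap`
  for `IsClosedImmersion` + `IsClosedImmersion.spec_of_surjective` (residue map `W_{n+1} → k` is onto).
* `stub_thickeningMap_firstOrder_proof` — stub **G1** VERBATIM: `X_{n+1} ⟶ X_{n+2}` is an
  `IsFirstOrderThickening` for ANY `W(k)`-scheme (no smoothness, no perfectness, `k` any ring):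
  closed immersion as above; square-zero because `X_m ≅ X_{n'} ×_{Spec W_{n'}} Spec W_m` over `X_{n'}`
  (`thickeningMap_eq`, pullback pasting), so `ker(X_m → X_{n'}) = f⁻¹ ker(Spec W_m → Spec W_{n'})`
  (`Scheme.IdealSheafData.ker_fst_of_isClosedImmersion`), inverse images commute with products
  (`Resolution.comap_mul`), and `ker(Spec W_m → Spec W_{n'})² = 0` for `n' ≤ 2m` (global sections of the
  affine scheme `Spec W_{n'}`, `(p)^m · (p)^m ⊆ (p)^{n'}`; `appTop_factor_mul_eq_zero`).

`lean check` rc 0, 0 sorry; axioms {propext, Classical.choice, Quot.sound}.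
-/

noncomputable section

open CategoryTheory AlgebraicGeometry Limits
open Literature.AlgebraicGeometry.Motives Literature.AlgebraicGeometry.Motives.WittScheme
  Literature.AlgebraicGeometry.Deformation

set_option linter.dupNamespace false

namespace Summit.HodgeConjecture.HodgeConjecture.Cruxes.PadicPridhamSemiregularity.SigmaObKzeroAdditivity.Drefute

variable {p : ℕ} [Fact p.Prime] {k : Type} [CommRing k] (𝒳 : SchemeOver (WittVector p k))

/-- The residue map `W_{n+1}(k) = W(k)/p^{n+1} → k` is surjective. [folklore] -/
theorem wittQuotToResidue_surjective [CharP k p] (n : ℕ) :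
    Function.Surjective (wittQuotToResidue p k n) := by
  intro x
  obtain ⟨w, hw⟩ := (WittVector.constantCoeff_surjective (p := p) (R := k)) x
  exact ⟨algebraMap (WittVector p k) (wittQuot p k (n + 1)) w, by
    rw [← hw]; exact congrFun (congrArg DFunLike.coe (wittQuotToResidue_comp_algebraMap p k n)) w⟩

/-- **Stub G2**: `X_k ⟶ X_{n+1}` is a closed immersion, for ANY `W(k)`-scheme `𝒳` and any ring `k`
of characteristic `p` (base change of `Spec k ⟶ Spec W_{n+1}`). [folklore] -/
theorem isClosedImmersion_specialFibreToThickening [CharP k p] (n : ℕ) :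
    IsClosedImmersion (specialFibreToThickening 𝒳 n) := by
  have e₂ : Spec.map (CommRingCat.ofHom (WittVector.constantCoeff : WittVector p k →+* k)) =
      Spec.map (CommRingCat.ofHom (wittQuotToResidue p k n)) ≫
        Spec.map (CommRingCat.ofHom (algebraMap (WittVector p k) (wittQuot p k (n + 1)))) := by
    rw [← Spec.map_comp, ← CommRingCat.ofHom_comp, wittQuotToResidue_comp_algebraMap]
  exact MorphismProperty.pullbackMap (P := @IsClosedImmersion) (f := 𝒳.hom)
    (g := Spec.map (CommRingCat.ofHom (WittVector.constantCoeff : WittVector p k →+* k)))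
    (f' := 𝒳.hom) (i₁ := 𝟙 _)
    (g' := Spec.map (CommRingCat.ofHom (algebraMap (WittVector p k) (wittQuot p k (n + 1)))))
    (i₂ := Spec.map (CommRingCat.ofHom (wittQuotToResidue p k n)))
    inferInstance (IsClosedImmersion.spec_of_surjective _ (wittQuotToResidue_surjective n))
    (Category.id_comp _).symm e₂

/-- **Closed-immersion half of stub G1**: the transition `X_m ⟶ X_{n'}` (`m ≤ n'`) is a closed
immersion, for ANY `W(k)`-scheme `𝒳` (base change of `Spec W_m ⟶ Spec W_{n'}`). [folklore] -/
theorem isClosedImmersion_thickeningMap {m n' : ℕ} (hmn : m ≤ n') :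
    IsClosedImmersion (thickeningMap 𝒳 hmn) := by
  have hs : Function.Surjective
      (Ideal.Quotient.factor (Ideal.pow_le_pow_right hmn :
        Ideal.span {(p : WittVector p k)} ^ n' ≤ Ideal.span {(p : WittVector p k)} ^ m)) :=
    Ideal.Quotient.factor_surjective _
  have e₂ : Spec.map (CommRingCat.ofHom (algebraMap (WittVector p k) (wittQuot p k m))) =
      Spec.map (CommRingCat.ofHom (Ideal.Quotient.factor (Ideal.pow_le_pow_right hmn))) ≫
        Spec.map (CommRingCat.ofHom (algebraMap (WittVector p k) (wittQuot p k n'))) := by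
    rw [← Spec.map_comp, ← CommRingCat.ofHom_comp]; rfl
  exact MorphismProperty.pullbackMap (P := @IsClosedImmersion) (f := 𝒳.hom)
    (g := Spec.map (CommRingCat.ofHom (algebraMap (WittVector p k) (wittQuot p k m))))
    (f' := 𝒳.hom) (i₁ := 𝟙 _)
    (g' := Spec.map (CommRingCat.ofHom (algebraMap (WittVector p k) (wittQuot p k n'))))
    (i₂ := Spec.map (CommRingCat.ofHom (Ideal.Quotient.factor (Ideal.pow_le_pow_right hmn))))
    inferInstance (IsClosedImmersion.spec_of_surjective _ hs)
    (Category.id_comp _).symm e₂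

/-- Stub G2 in its registered shape (verbatim binders). [folklore] -/
theorem stub_specialFibreToThickening_closedImmersion_proof :
    ∀ (p : ℕ) [Fact p.Prime] (k : Type) [Field k] [CharP k p] (𝒳 : SchemeOver (WittVector p k)) (n : ℕ),
      IsClosedImmersion (specialFibreToThickening 𝒳 n) :=
  fun _ _ _ _ _ 𝒳 n => isClosedImmersion_specialFibreToThickening 𝒳 n


/-- `Spec W_r → Spec W`. -/
abbrev gW (p : ℕ) [Fact p.Prime] (k : Type) [CommRing k] (r : ℕ) :
    Spec (CommRingCat.of (wittQuot p k r)) ⟶ Spec (CommRingCat.of (WittVector p k)) :=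
  Spec.map (CommRingCat.ofHom (algebraMap (WittVector p k) (wittQuot p k r)))

/-- `Spec W_m → Spec W_{n'}` for `m ≤ n'`. -/
abbrev qW (p : ℕ) [Fact p.Prime] (k : Type) [CommRing k] {m n' : ℕ} (hmn : m ≤ n') :
    Spec (CommRingCat.of (wittQuot p k m)) ⟶ Spec (CommRingCat.of (wittQuot p k n')) :=
  Spec.map (CommRingCat.ofHom (Ideal.Quotient.factor (Ideal.pow_le_pow_right hmn :
    Ideal.span {(p : WittVector p k)} ^ n' ≤ Ideal.span {(p : WittVector p k)} ^ m)))

theorem gW_eq {m n' : ℕ} (hmn : m ≤ n') : gW p k m = qW p k hmn ≫ gW p k n' := by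
  rw [← Spec.map_comp, ← CommRingCat.ofHom_comp]; rfl

instance isClosedImmersion_qW {m n' : ℕ} (hmn : m ≤ n') : IsClosedImmersion (qW p k hmn) :=
  IsClosedImmersion.spec_of_surjective _
    (Ideal.Quotient.factor_surjective (Ideal.pow_le_pow_right hmn :
      Ideal.span {(p : WittVector p k)} ^ n' ≤ Ideal.span {(p : WittVector p k)} ^ m))

/-- Square-zero kernels on global sections: for `I ≤ J` with `J² ≤ I`, two global sections of
`Spec (A ⧸ I)` killed by restriction to `Spec (A ⧸ J)` have zero product. -/
theorem appTop_factor_mul_eq_zero {A : Type} [CommRing A] {I J : Ideal A} (hIJ : I ≤ J)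
    (hJ2 : J * J ≤ I) (a b : Γ(Spec (CommRingCat.of (A ⧸ I)), ⊤))
    (ha : (Spec.map (CommRingCat.ofHom (Ideal.Quotient.factor hIJ))).appTop a = 0)
    (hb : (Spec.map (CommRingCat.ofHom (Ideal.Quotient.factor hIJ))).appTop b = 0) : a * b = 0 := by
  have hnat : ∀ x : Γ(Spec (CommRingCat.of (A ⧸ I)), ⊤),
      (Scheme.ΓSpecIso (CommRingCat.of (A ⧸ J))).hom
          ((Spec.map (CommRingCat.ofHom (Ideal.Quotient.factor hIJ))).appTop x) =
        Ideal.Quotient.factor hIJ ((Scheme.ΓSpecIso (CommRingCat.of (A ⧸ I))).hom x) := fun x => by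
    have := Scheme.ΓSpecIso_naturality (CommRingCat.ofHom (Ideal.Quotient.factor hIJ))
    exact congrFun (congrArg (fun g => (ConcreteCategory.hom g :
      Γ(Spec (CommRingCat.of (A ⧸ I)), ⊤) → CommRingCat.of (A ⧸ J))) this) x
  have hmem : ∀ x : Γ(Spec (CommRingCat.of (A ⧸ I)), ⊤),
      (Spec.map (CommRingCat.ofHom (Ideal.Quotient.factor hIJ))).appTop x = 0 →
      ∃ r ∈ J, (Scheme.ΓSpecIso (CommRingCat.of (A ⧸ I))).hom x = Ideal.Quotient.mk I r := by
    intro x hx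
    obtain ⟨r, hr⟩ := Ideal.Quotient.mk_surjective ((Scheme.ΓSpecIso (CommRingCat.of (A ⧸ I))).hom x)
    refine ⟨r, ?_, hr.symm⟩
    have h1 := hnat x
    rw [hx, map_zero, ← hr] at h1
    have h2 : Ideal.Quotient.factor hIJ (Ideal.Quotient.mk I r) = 0 := h1.symm
    rwa [Ideal.Quotient.factor_mk, Ideal.Quotient.eq_zero_iff_mem] at h2
  obtain ⟨r, hr, hra⟩ := hmem a ha
  obtain ⟨s, hs, hsb⟩ := hmem b hb
  have hrs : r * s ∈ I := hJ2 (Ideal.mul_mem_mul hr hs)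
  have hab : (Scheme.ΓSpecIso (CommRingCat.of (A ⧸ I))).hom (a * b) =
      (Scheme.ΓSpecIso (CommRingCat.of (A ⧸ I))).hom 0 := by
    rw [map_mul, hra, hsb, ← map_mul, map_zero, Ideal.Quotient.eq_zero_iff_mem]; exact hrs
  exact (Scheme.ΓSpecIso (CommRingCat.of (A ⧸ I))).commRingCatIsoToRingEquiv.injective hab

/-- The square of the kernel ideal sheaf of `Spec W_m → Spec W_{n'}` vanishes when `n' ≤ 2m`. -/
theorem ker_qW_mul_self {m n' : ℕ} (hmn : m ≤ n') (h2 : n' ≤ 2 * m) :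
    (qW p k hmn).ker * (qW p k hmn).ker = ⊥ := by
  refine le_bot_iff.mp (Scheme.IdealSheafData.le_of_isAffine ?_)
  rw [Scheme.IdealSheafData.ideal_mul, Pi.mul_apply, Scheme.IdealSheafData.ideal_bot, Pi.bot_apply,
    Scheme.Hom.ker_apply, Ideal.mul_le]
  intro a ha b hb
  rw [RingHom.mem_ker] at ha hb
  have hJ2 : Ideal.span {(p : WittVector p k)} ^ m * Ideal.span {(p : WittVector p k)} ^ m ≤
      Ideal.span {(p : WittVector p k)} ^ n' := by
    rw [← pow_add, ← two_mul]; exact Ideal.pow_le_pow_right h2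
  exact appTop_factor_mul_eq_zero (Ideal.pow_le_pow_right hmn) hJ2 a b ha hb

set_option backward.isDefEq.respectTransparency false in
/-- `X_m ≅ X_{n'} ×_{W_{n'}} W_m` over `X_{n'}`: the transition map is a base change of `qW`. -/
theorem thickeningMap_eq {m n' : ℕ} (hmn : m ≤ n') :
    (pullback.congrHom rfl (gW_eq (p := p) (k := k) hmn) ≪≫
        (pullbackLeftPullbackSndIso 𝒳.hom (gW p k n') (qW p k hmn)).symm).hom ≫
      pullback.fst (pullback.snd 𝒳.hom (gW p k n')) (qW p k hmn) = thickeningMap 𝒳 hmn := by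
  apply pullback.hom_ext
  · simp only [thickeningMap, Iso.trans_hom, Iso.symm_hom, pullback.congrHom_hom, Category.assoc,
      pullbackLeftPullbackSndIso_inv_fst, pullback.lift_fst, Category.comp_id]
  · simp only [thickeningMap, Iso.trans_hom, Iso.symm_hom, pullback.congrHom_hom, Category.assoc,
      pullbackLeftPullbackSndIso_inv_fst_snd, pullback.lift_snd, pullback.lift_snd_assoc,
      Category.comp_id]

set_option backward.isDefEq.respectTransparency false in
/-- `ker(X_m → X_{n'})` is the inverse image of `ker(Spec W_m → Spec W_{n'})`. -/
theorem ker_thickeningMap_eq {m n' : ℕ} (hmn : m ≤ n') :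
    (thickeningMap 𝒳 hmn).ker = (qW p k hmn).ker.comap (pullback.snd 𝒳.hom (gW p k n')) := by
  have h := congrArg Scheme.Hom.ker (thickeningMap_eq 𝒳 hmn)
  rw [Scheme.Hom.ker_comp_of_isIso, Scheme.IdealSheafData.ker_fst_of_isClosedImmersion] at h
  exact h.symm

/-- **Stub G1 (square-zero half)**: `ker(X_m → X_{n'})² = 0` for `m ≤ n' ≤ 2m`, ANY `W(k)`-scheme. -/
theorem ker_thickeningMap_mul_self {m n' : ℕ} (hmn : m ≤ n') (h2 : n' ≤ 2 * m) :
    (thickeningMap 𝒳 hmn).ker * (thickeningMap 𝒳 hmn).ker = ⊥ := by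
  have h : (qW p k hmn).ker.comap (pullback.snd 𝒳.hom (gW p k n')) *
      (qW p k hmn).ker.comap (pullback.snd 𝒳.hom (gW p k n')) =
        (⊥ : (pullback 𝒳.hom (gW p k n')).IdealSheafData) := by
    rw [← Literature.AlgebraicGeometry.Resolution.comap_mul, ker_qW_mul_self hmn h2,
      Scheme.IdealSheafData.comap_bot]
  rw [ker_thickeningMap_eq]
  exact h

/-- **Stub G1 in its registered shape (verbatim binders)**: the transition `X_{n+1} ⟶ X_{n+2}` is a
first-order thickening, for every `W(k)`-scheme. [folklore] -/
theorem stub_thickeningMap_firstOrder_proof :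
    ∀ (p : ℕ) [Fact p.Prime] (k : Type) [Field k] [CharP k p] (𝒳 : SchemeOver (WittVector p k)) (n : ℕ),
      IsFirstOrderThickening (thickeningMap 𝒳 (Nat.le_succ (n + 1))) := fun _ _ _ _ _ 𝒳 n =>
  haveI := isClosedImmersion_thickeningMap 𝒳 (Nat.le_succ (n + 1))
  { ker_mul_ker_eq_bot := ker_thickeningMap_mul_self 𝒳 (Nat.le_succ (n + 1)) (by omega) }

/-- G1 for any ring `k` of characteristic... in fact any commutative ring `k` (no `Field`, no `CharP`). -/
theorem isFirstOrderThickening_thickeningMap (n : ℕ) :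
    IsFirstOrderThickening (thickeningMap 𝒳 (Nat.le_succ (n + 1))) :=
  haveI := isClosedImmersion_thickeningMap 𝒳 (Nat.le_succ (n + 1))
  { ker_mul_ker_eq_bot := ker_thickeningMap_mul_self 𝒳 (Nat.le_succ (n + 1)) (by omega) }

end Summit.HodgeConjecture.HodgeConjecture.Cruxes.PadicPridhamSemiregularity.SigmaObKzeroAdditivity.Drefute

end
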